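import Summits.CriticalPhenomena.PercolationContinuityZ3.Theorems.PercNearOneGluingNoHeavyQuantIndepBlobTwoLevelRow
import Summits.CriticalPhenomena.PercolationContinuityZ3.Theorems.PercNearOneGluingNoHeavyQuantIndepBlobFar
import Summits.CriticalPhenomena.PercolationContinuityZ3.Theorems.PercNearOneGluingNoHeavyQuantMergeStep
import HarnessLib

/-!
# QUANT lane R8, FAR for independent blobs (IX): the GRADED MERGE ROW — blobs BELOW the floor count at FULL credit
# as soon as each of them can be merged upward (`gate · (mass of the strictly more reliable blobs) ≥ j`)

builds on p205010 (kernel theorem, internal audit signed; external expert review pending)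

Support file (`--supports stmt-CriticalPhenomena-4575`), QUANT lane seat prim-quant-p1 (gen 11); memo
`run/shared/lean/prim/quant/P1-SURPLUS.md` §22.  Theorems only; no definitions, no sorries, standard axioms.  Vocabulary of
`…QuantIndepBlobMoments` / `…QuantIndepBlobFar`: a finite type of blobs with gates `p k ∈ [0,1]` and integer sizes `a k`, a configuration
is the finset `s` of open blobs with product weight `∏_k (p k if k ∈ s else 1 − p k)`, and `N(s) = Σ_{k ∈ s} a k`.

**Context (T-DIB, README V185).**  The R8 architecture of record for `Quant.FarTreeRow` on general trees (census-2 g49) needs ONE row for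
independent blobs with some blobs below the floor `x` (Conjecture DIB\*, `Quant.IndepBlob.DIBStar`, `…QuantDIBStar.lean`): heavy blobs
(gate `≥ x`) credited `a·p`, light ones at a discount, credit `> 2j ⟹ P(N ≥ j+1) ≥ x`.  Kernel so far: floors `≤ 1/2` (lead g15), heavy
total `≥ 2j+1` (lead g15), one light blob for `x³ + x ≥ 1` (census-1 g14).  The open corner is `x > 1/2`, heavy total `≤ 2j`, several light
blobs — the LUMPY regime (two tied near-giants plus light mass), where DIB\* is nearly sharp (census-2 g49 §8 F4: TAIL/x = 1.043 at x = 19/20).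

**Theorem (graded merge row, `tail_ge_of_gradedMerge`).**  Gates `p k ∈ [0,1]`, integer sizes, a floor `x ≤ 1`, a layer `j`.  Suppose every
blob `k` below the floor (`p k < x`) is MERGEABLE: `j ≤ p k · M_k` where `M_k = Σ_{i : p k < p i} a i` is the mass of the strictly more reliable
blobs, and some strictly more reliable blob has positive size.  If `2j < Σ_k a k · p k` (the TRUE mean — every blob at FULL credit) then
`x ≤ P(N ≥ j+1)`.  In particular (`tail_ge_of_mergeable_light`): heavy blobs with gates `≥ x`, light blobs with `p k · A_H ≥ j`
(`A_H` = heavy mass), `2j < Σ a p ⟹ P(N ≥ j+1) ≥ x` — Conjecture DIB\* with the discount REMOVED on its mergeable instances (any floor, any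
number and sizes of light blobs, no `a ≤ j` hypothesis).  On the near-sharp family of DIB\* (two tied `j`-blobs at gate `x` plus a light
`j`-blob of gate `g`: `P(N ≥ j+1) = x² + 2x(1−x)g ≥ x ⟺ g ≥ 1/2`) the merge condition `g · 2j ≥ j` is EXACTLY the truth.

**Proof.**  Induction on the number of blobs below the floor.  None: `IndepBlob.far_indepBlob` (all gates `≥ x`).  Otherwise take a light
blob `k₀` of LEAST gate `g`, condition on everything else (`IndepBlob.tail_split`), and apply p1 g8's law-free merge step
`Quant.Merge.exists_tailMerge_le` with targets = the strictly more reliable blobs weighted by size: since `j ≤ g · M_{k₀}`, moving the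
`a k₀` relays INTO some target `ℓ` (`p ℓ > g`) does not raise `P(N ≥ j+1)`.  The merged system has one light blob fewer, a larger mean
(`a k₀ · p ℓ ≥ a k₀ · g`), and every remaining light blob `k` keeps its merge condition: `p k ≥ g`, so `k₀` was not among its targets, and the
mass it received sits in `ℓ`, still a target of `k` whenever it was (`M_k` never decreases).  Nearest prior art: majorisation / Schur-convexity
of tails of weighted Bernoulli sums (Marshall–Olkin–Arnold ch. 12, Proschan 1965) — symmetric weights, no floor; recorded [this work].
[cite: KozmaNitzan2024, Conjecture 3 (p. 15)] (the gluing rows served).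

* `IndepBlob.sum_filter_subtype_ne` — reindexing a filtered sum over the subtype `{k // k ≠ y}`.
* `IndepBlob.tail_ge_floor_of_heavy` — no blob below the floor: `far_indepBlob` in the present vocabulary.
* `IndepBlob.tail_ge_of_gradedMerge` — THE ROW; `IndepBlob.tail_ge_of_gradedMerge'` — indicator form (shape of `IndepBlob.DIBWith`).
* `IndepBlob.tail_ge_of_mergeable_light` — the DIB-shaped corollary (targets = the heavy blobs).
-/

namespace Summit.CriticalPhenomena.PercolationContinuityZ3.Theorems

namespace Quant

namespace IndepBlob

open Finset

universe u

variable {κ : Type*} [Fintype κ] [DecidableEq κ]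

/-- Reindexing: a sum over the finsets-of-the-subtype filter `{i : {k // k ≠ y} | P i}` is the sum over `(univ.filter P).erase y`. [folklore] -/
theorem sum_filter_subtype_ne {M : Type*} [AddCommMonoid M] (y : κ) (P : κ → Prop) [DecidablePred P] (f : κ → M) :
    ∑ i ∈ (Finset.univ : Finset {k : κ // k ≠ y}).filter (fun i : {k : κ // k ≠ y} => P i.1), f i.1 =
      ∑ i ∈ ((Finset.univ : Finset κ).filter P).erase y, f i := by
  rw [Finset.sum_filter]
  have h1 : ∑ i : {k : κ // k ≠ y}, (if P i.1 then f i.1 else 0) =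
      ∑ i ∈ (Finset.univ : Finset κ).erase y, (if P i then f i else 0) := by
    rw [Finset.sum_subtype ((Finset.univ : Finset κ).erase y) (p := fun k => k ≠ y) (fun k => by simp)]
  rw [h1, ← Finset.sum_filter]
  congr 1
  ext i
  simp only [Finset.mem_filter, Finset.mem_erase, Finset.mem_univ, true_and, and_true]

/-- **No blob below the floor** (`x ≤ p k` for every `k`, `x ≤ 1`, `2j < Σ a p`): `x ≤ P(N ≥ j+1)`.  This is `IndepBlob.far_indepBlob`
(distinguished blob of weight `0`) read in the present vocabulary; trivial for `x < 0`. [this work] -/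
theorem tail_ge_floor_of_heavy (p : κ → ℝ) (a : κ → ℕ) (x : ℝ) (j : ℕ) (hp0 : ∀ k, 0 ≤ p k) (hp1 : ∀ k, p k ≤ 1)
    (hx1 : x ≤ 1) (hheavy : ∀ k, x ≤ p k) (hmean : (2 * j : ℝ) < ∑ k, (a k : ℝ) * p k) :
    x ≤ ∑ s ∈ (Finset.univ : Finset (Finset κ)).filter (fun s => j + 1 ≤ ∑ k ∈ s, a k),
      (∏ k, if k ∈ s then p k else 1 - p k) := by
  have hw0 : ∀ W : Finset κ, 0 ≤ (∏ k, if k ∈ W then p k else 1 - p k) := bernoulliWeight_nonneg hp0 hp1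
  by_cases hx0 : 0 ≤ x
  swap
  · exact le_trans (le_of_lt (not_le.1 hx0)) (Finset.sum_nonneg fun W _ => hw0 W)
  -- `far_indepBlob` with the distinguished blob `(x, 0)`
  have key := far_indepBlob p (fun k => (a k : ℝ)) x 0 hx0 hx1 hheavy hp1 (fun k => Nat.cast_nonneg (a k)) le_rfl (j : ℝ)
    (by rw [zero_mul, zero_add]; exact hmean)
  -- both events of `far_indepBlob` are `{a(W) ≤ j}`
  have hf1 : (Finset.univ : Finset (Finset κ)).filter (fun W => ∑ i ∈ W, (a i : ℝ) + 0 ≤ (j : ℝ)) =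
      (Finset.univ : Finset (Finset κ)).filter (fun W => ∑ i ∈ W, a i ≤ j) := by
    ext W
    simp only [Finset.mem_filter, Finset.mem_univ, true_and, add_zero]
    rw [← Nat.cast_sum, Nat.cast_le]
  have hf2 : (Finset.univ : Finset (Finset κ)).filter (fun W => ∑ i ∈ W, (a i : ℝ) ≤ (j : ℝ)) =
      (Finset.univ : Finset (Finset κ)).filter (fun W => ∑ i ∈ W, a i ≤ j) := by
    ext W
    simp only [Finset.mem_filter, Finset.mem_univ, true_and]
    rw [← Nat.cast_sum, Nat.cast_le]
  rw [hf1, hf2] at key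
  set S := ∑ W ∈ (Finset.univ : Finset (Finset κ)).filter (fun W => ∑ i ∈ W, a i ≤ j),
    (∏ k, if k ∈ W then p k else 1 - p k) with hS
  have hS1 : S ≤ 1 - x := by nlinarith [key]
  -- complement
  have hnot : (Finset.univ : Finset (Finset κ)).filter (fun s => ¬ (j + 1 ≤ ∑ k ∈ s, a k)) =
      (Finset.univ : Finset (Finset κ)).filter (fun W => ∑ i ∈ W, a i ≤ j) := by
    ext W
    simp only [Finset.mem_filter, Finset.mem_univ, true_and, not_le, Nat.lt_succ_iff]
  have htot : ∑ s ∈ (Finset.univ : Finset (Finset κ)).filter (fun s => j + 1 ≤ ∑ k ∈ s, a k),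
      (∏ k, if k ∈ s then p k else 1 - p k) + S = 1 := by
    rw [hS, ← hnot, Finset.sum_filter_add_sum_filter_not, sum_bernoulliWeight]
  linarith

/-- The graded merge row with an explicit bound `n` on the number of blobs below the floor (the induction). [this work] -/
theorem tail_ge_of_gradedMerge_le (n : ℕ) :
    ∀ {κ : Type u} [Fintype κ] [DecidableEq κ] (p : κ → ℝ) (a : κ → ℕ) (x : ℝ) (j : ℕ),
      (∀ k, 0 ≤ p k) → (∀ k, p k ≤ 1) → x ≤ 1 →
      ((Finset.univ : Finset κ).filter (fun k => p k < x)).card ≤ n →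
      (∀ k, p k < x → (j : ℝ) ≤ p k * ∑ i ∈ (Finset.univ : Finset κ).filter (fun i => p k < p i), (a i : ℝ)) →
      (∀ k, p k < x → ∃ i, p k < p i ∧ 0 < a i) →
      (2 * j : ℝ) < ∑ k, (a k : ℝ) * p k →
      x ≤ ∑ s ∈ (Finset.univ : Finset (Finset κ)).filter (fun s => j + 1 ≤ ∑ k ∈ s, a k),
        (∏ k, if k ∈ s then p k else 1 - p k) := by
  induction n with
  | zero =>
    intro κ _ _ p a x j hp0 hp1 hx1 hcard hM hM0 hmean
    have hheavy : ∀ k, x ≤ p k := by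
      intro k
      by_contra h
      have hk : k ∈ (Finset.univ : Finset κ).filter (fun k => p k < x) :=
        Finset.mem_filter.2 ⟨Finset.mem_univ _, not_le.1 h⟩
      have := Finset.card_pos.2 ⟨k, hk⟩
      omega
    exact tail_ge_floor_of_heavy p a x j hp0 hp1 hx1 hheavy hmean
  | succ n ih =>
    intro κ _ _ p a x j hp0 hp1 hx1 hcard hM hM0 hmean
    set L := (Finset.univ : Finset κ).filter (fun k => p k < x) with hL
    by_cases hLne : L.Nonempty
    swap
    · -- no light blob at all
      have hheavy : ∀ k, x ≤ p k := by
        intro k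
        by_contra h
        exact hLne ⟨k, Finset.mem_filter.2 ⟨Finset.mem_univ _, not_le.1 h⟩⟩
      exact tail_ge_floor_of_heavy p a x j hp0 hp1 hx1 hheavy hmean
    -- the light blob of least gate
    obtain ⟨k₀, hk₀L, hk₀min⟩ := Finset.exists_min_image L p hLne
    have hk₀ : p k₀ < x := (Finset.mem_filter.1 hk₀L).2
    have hmin : ∀ k, p k < x → p k₀ ≤ p k := fun k hk => hk₀min k (Finset.mem_filter.2 ⟨Finset.mem_univ _, hk⟩)
    set ι := {k : κ // k ≠ k₀} with hι
    -- targets: the strictly more reliable blobs, weighted by size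
    set c : ι → ℕ := fun i : ι => if p k₀ < p i.1 then a i.1 else 0 with hc
    set z : Finset ι → ℕ := fun W => ∑ i ∈ W, (if p k₀ < p i.1 then 0 else a i.1) with hz
    have hcz : ∀ W : Finset ι, ∑ i ∈ W, c i + z W = ∑ i ∈ W, a i.1 := by
      intro W
      rw [hz, ← Finset.sum_add_distrib]
      refine Finset.sum_congr rfl fun i _ => ?_
      simp only [hc]
      split_ifs <;> simp
    have hSumc : (∑ i : ι, (c i : ℝ)) = ∑ i ∈ (Finset.univ : Finset κ).filter (fun i => p k₀ < p i), (a i : ℝ) := by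
      have h1 : (∑ i : ι, (c i : ℝ)) = ∑ i : ι, (if p k₀ < p i.1 then (a i.1 : ℝ) else 0) := by
        refine Finset.sum_congr rfl fun i _ => ?_
        simp only [hc]
        split_ifs <;> simp
      rw [h1, ← Finset.sum_filter, sum_filter_subtype_ne k₀ (fun i => p k₀ < p i) (fun i => (a i : ℝ)),
        Finset.erase_eq_of_notMem]
      intro h
      exact lt_irrefl _ (Finset.mem_filter.1 h).2
    have hMc : (j : ℝ) ≤ p k₀ * ∑ i : ι, (c i : ℝ) := by rw [hSumc]; exact hM k₀ hk₀
    have hpos : ∃ i : ι, 0 < c i := by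
      obtain ⟨i, hi, hai⟩ := hM0 k₀ hk₀
      refine ⟨⟨i, fun h => ?_⟩, ?_⟩
      · rw [h] at hi; exact lt_irrefl _ hi
      · show 0 < (if p k₀ < p i then a i else 0)
        rw [if_pos hi]; exact hai
    -- the product weight on the subtype
    set μ : Finset ι → ℝ := fun W => ∏ i : ι, (if i ∈ W then p i.1 else 1 - p i.1) with hμ
    have hμ0 : ∀ W, 0 ≤ μ W := fun W =>
      bernoulliWeight_nonneg (p := fun i : ι => p i.1) (fun i => hp0 i.1) (fun i => hp1 i.1) W
    -- THE MERGE STEP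
    obtain ⟨ℓ, hcℓ, hmerge⟩ := Merge.exists_tailMerge_le μ hμ0 (fun W => W) z c (a k₀) j (p k₀) hMc hpos
    have hℓ : p k₀ < p ℓ.1 := by
      by_contra h
      have : c ℓ = 0 := by simp only [hc]; rw [if_neg h]
      omega
    -- the merged sizes on the subtype
    set a' : ι → ℕ := fun i : ι => a i.1 + (if i = ℓ then a k₀ else 0) with ha'
    have ha'W : ∀ W : Finset ι, ∑ i ∈ W, a' i = ∑ i ∈ W, a i.1 + (if ℓ ∈ W then a k₀ else 0) := by
      intro W
      rw [ha', Finset.sum_add_distrib, Finset.sum_ite_eq' W ℓ]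
    -- (1) the original tail, conditioned on `k₀`, is the merge lemma's `T₀`
    have hT0 : ∑ s ∈ (Finset.univ : Finset (Finset κ)).filter (fun s => j + 1 ≤ ∑ k ∈ s, a k),
          (∏ k, if k ∈ s then p k else 1 - p k) =
        ∑ W : Finset ι, μ W * (p k₀ * (if j + 1 ≤ ∑ i ∈ W, c i + z W + a k₀ then (1 : ℝ) else 0) +
          (1 - p k₀) * (if j + 1 ≤ ∑ i ∈ W, c i + z W then (1 : ℝ) else 0)) := by
      rw [tail_split p a k₀ (j + 1)]
      simp_rw [hcz]
      rw [Finset.sum_filter, Finset.sum_filter, Finset.mul_sum, Finset.mul_sum, ← Finset.sum_add_distrib]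
      refine Finset.sum_congr rfl fun W _ => ?_
      have e : a k₀ + ∑ i ∈ W, a i.1 = ∑ i ∈ W, a i.1 + a k₀ := by rw [add_comm]
      rw [e]
      split_ifs <;> ring
    -- (2) the merged tail is the tail of the system `(p, a')` on the subtype
    have hTℓ : ∑ W : Finset ι, μ W * (if j + 1 ≤ ∑ i ∈ W, c i + z W + (if ℓ ∈ W then a k₀ else 0) then (1 : ℝ) else 0) =
        ∑ W ∈ (Finset.univ : Finset (Finset ι)).filter (fun W => j + 1 ≤ ∑ i ∈ W, a' i), μ W := by
      rw [Finset.sum_filter]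
      refine Finset.sum_congr rfl fun W _ => ?_
      rw [hcz W, ← ha'W W]
      split_ifs <;> simp
    -- (3) the induction hypothesis for the merged system
    have hcard' : ((Finset.univ : Finset ι).filter (fun i : ι => p i.1 < x)).card ≤ n := by
      have h1 : ((Finset.univ : Finset ι).filter (fun i : ι => p i.1 < x)).card = (L.erase k₀).card := by
        rw [Finset.card_eq_sum_ones, Finset.card_eq_sum_ones, hL]
        exact sum_filter_subtype_ne k₀ (fun i => p i < x) (fun _ => 1)
      rw [h1, Finset.card_erase_of_mem hk₀L]
      omega
    have hM' : ∀ k : ι, p k.1 < x →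
        (j : ℝ) ≤ p k.1 * ∑ i ∈ (Finset.univ : Finset ι).filter (fun i : ι => p k.1 < p i.1), (a' i : ℝ) := by
      intro k hk
      have hMk := hM k.1 hk
      have hle : ∑ i ∈ (Finset.univ : Finset κ).filter (fun i => p k.1 < p i), (a i : ℝ) ≤
          ∑ i ∈ (Finset.univ : Finset ι).filter (fun i : ι => p k.1 < p i.1), (a' i : ℝ) := by
        have hnot : k₀ ∉ (Finset.univ : Finset κ).filter (fun i => p k.1 < p i) := by
          intro h
          have := (Finset.mem_filter.1 h).2
          linarith [hmin k.1 hk]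
        rw [← Finset.erase_eq_of_notMem hnot, ← sum_filter_subtype_ne k₀ (fun i => p k.1 < p i) (fun i => (a i : ℝ))]
        refine Finset.sum_le_sum fun i _ => ?_
        simp only [ha']
        exact_mod_cast Nat.le_add_right (a i.1) _
      exact hMk.trans (mul_le_mul_of_nonneg_left hle (hp0 k.1))
    have hM0' : ∀ k : ι, p k.1 < x → ∃ i : ι, p k.1 < p i.1 ∧ 0 < a' i := by
      intro k hk
      obtain ⟨i, hi, hai⟩ := hM0 k.1 hk
      have hik₀ : i ≠ k₀ := by
        intro h
        rw [h] at hi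
        linarith [hmin k.1 hk]
      refine ⟨⟨i, hik₀⟩, hi, ?_⟩
      simp only [ha']
      omega
    have hmean' : (2 * j : ℝ) < ∑ i : ι, (a' i : ℝ) * p i.1 := by
      have hsplit : ∑ k, (a k : ℝ) * p k = (a k₀ : ℝ) * p k₀ + ∑ i : ι, (a i.1 : ℝ) * p i.1 := by
        rw [← Finset.add_sum_erase Finset.univ _ (Finset.mem_univ k₀),
          Finset.sum_subtype (Finset.univ.erase k₀) (p := fun k => k ≠ k₀) (fun k => by simp)]
      have hnew : ∑ i : ι, (a' i : ℝ) * p i.1 = (∑ i : ι, (a i.1 : ℝ) * p i.1) + (a k₀ : ℝ) * p ℓ.1 := by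
        have e : ∀ i : ι, (a' i : ℝ) * p i.1 = (a i.1 : ℝ) * p i.1 + (if i = ℓ then (a k₀ : ℝ) * p ℓ.1 else 0) := by
          intro i
          simp only [ha']
          split_ifs with h
          · subst h; push_cast; ring
          · push_cast; ring
        rw [Finset.sum_congr rfl fun i _ => e i, Finset.sum_add_distrib, Finset.sum_ite_eq' Finset.univ ℓ,
          if_pos (Finset.mem_univ _)]
      have hgain : (a k₀ : ℝ) * p k₀ ≤ (a k₀ : ℝ) * p ℓ.1 := mul_le_mul_of_nonneg_left hℓ.le (Nat.cast_nonneg _)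
      rw [hnew]
      rw [hsplit] at hmean
      linarith
    have IH := ih (κ := ι) (fun i : ι => p i.1) a' x j (fun i => hp0 i.1) (fun i => hp1 i.1) hx1 hcard' hM' hM0' hmean'
    -- (4) assemble
    calc x ≤ ∑ W ∈ (Finset.univ : Finset (Finset ι)).filter (fun W => j + 1 ≤ ∑ i ∈ W, a' i), μ W := IH
      _ = ∑ W : Finset ι, μ W *
            (if j + 1 ≤ ∑ i ∈ W, c i + z W + (if ℓ ∈ W then a k₀ else 0) then (1 : ℝ) else 0) := hTℓ.symm
      _ ≤ _ := hmerge
      _ = _ := hT0.symm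

/-- **THE GRADED MERGE ROW.**  Gates `0 ≤ p k ≤ 1`, integer sizes `a k`, a floor `x ≤ 1`, a layer `j`.  If every blob below the floor
(`p k < x`) is mergeable — `j ≤ p k · Σ_{i : p k < p i} a i`, and some strictly more reliable blob has positive size — and the TRUE mean
satisfies `2j < Σ_k a k · p k`, then `x ≤ P(N ≥ j+1) = Σ_{s : j+1 ≤ a(s)} w(s)`.  Light blobs at FULL credit, any number, any sizes.
[this work] -/
theorem tail_ge_of_gradedMerge (p : κ → ℝ) (a : κ → ℕ) (x : ℝ) (j : ℕ) (hp0 : ∀ k, 0 ≤ p k) (hp1 : ∀ k, p k ≤ 1)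
    (hx1 : x ≤ 1)
    (hM : ∀ k, p k < x → (j : ℝ) ≤ p k * ∑ i ∈ (Finset.univ : Finset κ).filter (fun i => p k < p i), (a i : ℝ))
    (hM0 : ∀ k, p k < x → ∃ i, p k < p i ∧ 0 < a i)
    (hmean : (2 * j : ℝ) < ∑ k, (a k : ℝ) * p k) :
    x ≤ ∑ s ∈ (Finset.univ : Finset (Finset κ)).filter (fun s => j + 1 ≤ ∑ k ∈ s, a k),
      (∏ k, if k ∈ s then p k else 1 - p k) :=
  tail_ge_of_gradedMerge_le _ p a x j hp0 hp1 hx1 le_rfl hM hM0 hmean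

/-- The graded merge row, indicator form (the shape of the conclusion of `IndepBlob.DIBWith`):
`x ≤ Σ_W w(W)·𝟙[j+1 ≤ a(W)]`. [this work] -/
theorem tail_ge_of_gradedMerge' (p : κ → ℝ) (a : κ → ℕ) (x : ℝ) (j : ℕ) (hp0 : ∀ k, 0 ≤ p k) (hp1 : ∀ k, p k ≤ 1)
    (hx1 : x ≤ 1)
    (hM : ∀ k, p k < x → (j : ℝ) ≤ p k * ∑ i ∈ (Finset.univ : Finset κ).filter (fun i => p k < p i), (a i : ℝ))
    (hM0 : ∀ k, p k < x → ∃ i, p k < p i ∧ 0 < a i)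
    (hmean : (2 * j : ℝ) < ∑ k, (a k : ℝ) * p k) :
    x ≤ ∑ W : Finset κ, (∏ k, if k ∈ W then p k else 1 - p k) * (if j + 1 ≤ ∑ k ∈ W, a k then (1 : ℝ) else 0) := by
  have h := tail_ge_of_gradedMerge p a x j hp0 hp1 hx1 hM hM0 hmean
  rw [Finset.sum_filter] at h
  refine h.trans (le_of_eq (Finset.sum_congr rfl fun W _ => ?_))
  split_ifs <;> simp

/-- **DIB-shaped corollary: mergeable light blobs at full credit.**  Floor `x ≤ 1`, gates in `[0,1]`, integer sizes; `A_H = Σ_{i : x ≤ p i} a i`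
the heavy mass, assumed to contain a blob of positive size.  If every LIGHT blob (`p k < x`) has `j ≤ p k · A_H` and `2j < Σ a p` (true mean,
no discount, no size restriction on the light blobs), then `x ≤ P(N ≥ j+1)`.  For heavy total `A_H = 2j` the condition reads: every light
gate is `≥ 1/2`. [this work] -/
theorem tail_ge_of_mergeable_light (p : κ → ℝ) (a : κ → ℕ) (x : ℝ) (j : ℕ) (hp0 : ∀ k, 0 ≤ p k) (hp1 : ∀ k, p k ≤ 1)
    (hx1 : x ≤ 1) (hH : ∃ i, x ≤ p i ∧ 0 < a i)
    (hM : ∀ k, p k < x → (j : ℝ) ≤ p k * ∑ i ∈ (Finset.univ : Finset κ).filter (fun i => x ≤ p i), (a i : ℝ))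
    (hmean : (2 * j : ℝ) < ∑ k, (a k : ℝ) * p k) :
    x ≤ ∑ s ∈ (Finset.univ : Finset (Finset κ)).filter (fun s => j + 1 ≤ ∑ k ∈ s, a k),
      (∏ k, if k ∈ s then p k else 1 - p k) := by
  refine tail_ge_of_gradedMerge p a x j hp0 hp1 hx1 (fun k hk => (hM k hk).trans ?_) (fun k hk => ?_) hmean
  · refine mul_le_mul_of_nonneg_left ?_ (hp0 k)
    refine Finset.sum_le_sum_of_subset_of_nonneg (fun i hi => ?_) fun i _ _ => Nat.cast_nonneg _
    rw [Finset.mem_filter] at hi ⊢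
    exact ⟨hi.1, lt_of_lt_of_le hk hi.2⟩
  · obtain ⟨i, hi, hai⟩ := hH
    exact ⟨i, lt_of_lt_of_le hk hi, hai⟩

end IndepBlob

end Quant

end Summit.CriticalPhenomena.PercolationContinuityZ3.Theorems
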